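import Mathlib
import HarnessLib
import Literature.MathematicalPhysics.QuantumLattice.HubbardTwoPointSimplexMatch

/-!
# Child `KLRegimeVolumeLimitV12` (stmt-HubbardSuperconductivity-19858), `stub_vl_bound` via (H1), step C3b: the SCALAR DICTIONARY between the
# limiting Grassmann entries `vertexLimitEntry` and the torus momentum sums of the two-time split-pair propagator matrix
# (seat hubbard-kl-k3c5-p1 g4; HOME/hubbard-kl-k3c5-p1/H1-DESIGN.md §5)

`T_γ(τ, τ′; y, y′; ς, ς′) := [ς′=ς] L⁻² Σ_k χ_k(y′ − y) e^{−(τ′−τ)(ε_k−μ)} f_γ(ε_k−μ)` is the momentum-sum value of the entries of the Hamiltonian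
matrix (`KLProgrammeKLRegimeVolumeLimitTwoTimeEntries.torusEntry`, written out here to keep this file independent).  With the Grassmann time
difference `d = τ_Q − τ_P` (annihilation minus creation) and operator times `τ′ − τ = d` (both legs shifted by `−β`):

* `vertexLimitEntry_eq_particle_of_neg` — `d < 0`: `vertexLimitEntry … d = T_β` (creation BEFORE annihilation in the word);
* `vertexLimitEntry_eq_neg_hole_of_pos` — `d > 0`: `vertexLimitEntry … d = −T_{−β}`;
* `vertexLimitEntry_zero_eq_particle_sub_half` — the diagonal: `vertexLimitEntry … x x σ σ 0 = T_β(τ,τ) − ½` (the `½` shift);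
* `vertexLimitEntry_extCol_eq_hole` — the column of the leading annihilation letter `c_{yσ′}` (operator time `0` ↔ Grassmann time `0`,
  the other leg at operator time `a − β` ↔ Grassmann `a`): `vertexLimitEntry … (0 − a) = +T_{−β}(a − β, 0)` — whereas the Hamiltonian entry is
  `−T_{−β}`: the antiperiodicity FLIP of column `0` (H1-DESIGN §5), generalising the anchor `vertexLimitEntry_neg_eq_fermiMatrix_entry`.
-/

noncomputable section

namespace Summit.HubbardSuperconductivity.HubbardSuperconductivity.Theorems.TwoPointAssembly

set_option linter.dupNamespace false -- summit = problem name (single-conjunct summit), D-0017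

open Finset NormedSpace Literature.MathematicalPhysics.QuantumLattice Literature.Probability.LatticeModels

variable {L : ℕ} [NeZero L]

omit [NeZero L] in
/-- `((1/L²:ℝ):ℂ) = (L²)⁻¹`. -/
private theorem cast_one_div_sq : ((1 / (L : ℝ) ^ 2 : ℝ) : ℂ) = ((L : ℂ) ^ 2)⁻¹ := by
  push_cast; rw [one_div]

/-- **`d < 0` (creation before annihilation): the limiting entry is the particle momentum sum.** -/
theorem vertexLimitEntry_eq_particle_of_neg (β μ : ℝ) (xa xb : TorusSite 2 L) (σ σ' : Fin 2) {d : ℝ} (hd : d < 0) {τ τ' : ℂ}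
    (hτ : τ' - τ = (d : ℂ)) :
    vertexLimitEntry L β μ xa xb σ σ' d =
      if σ' = σ then ((L : ℂ) ^ 2)⁻¹ * ∑ k : TorusSite 2 L, torusChar k (xb - xa) *
        (Complex.exp (-(τ' - τ) * ((torusBand L k - μ : ℝ) : ℂ)) * (fermiFunction β (torusBand L k - μ) : ℂ)) else 0 := by
  rw [vertexLimitEntry_eq_torusChar, hτ]
  by_cases hσ : σ = σ'
  · subst hσ
    rw [if_pos rfl, if_pos rfl, cast_one_div_sq, show xa - xb = -(xb - xa) by abel,
      sum_torusChar_neg_of_even _ _ (fun q => by simp only [nambuXi, torusBand_neg]), ← mul_neg, ← Finset.sum_neg_distrib]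
    refine congrArg _ (Finset.sum_congr rfl fun q _ => ?_)
    rw [← mul_neg]
    refine congrArg _ ?_
    rw [timeOrderedPropagator_of_neg β (nambuXi L μ q) hd, nambuXi, fermiFunction]
    push_cast
    rw [neg_neg, one_div, mul_comm]
    congr 2
    ring
  · rw [if_neg hσ, if_neg (Ne.symm hσ), neg_zero]

/-- **`d > 0` (annihilation before creation): the limiting entry is minus the hole momentum sum.** -/
theorem vertexLimitEntry_eq_neg_hole_of_pos (β μ : ℝ) (xa xb : TorusSite 2 L) (σ σ' : Fin 2) {d : ℝ} (hd : 0 < d) {τ τ' : ℂ}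
    (hτ : τ' - τ = (d : ℂ)) :
    vertexLimitEntry L β μ xa xb σ σ' d =
      -(if σ' = σ then ((L : ℂ) ^ 2)⁻¹ * ∑ k : TorusSite 2 L, torusChar k (xb - xa) *
        (Complex.exp (-(τ' - τ) * ((torusBand L k - μ : ℝ) : ℂ)) * (fermiFunction (-β) (torusBand L k - μ) : ℂ)) else 0) := by
  rw [vertexLimitEntry_eq_torusChar, hτ]
  by_cases hσ : σ = σ'
  · subst hσ
    rw [if_pos rfl, if_pos rfl, cast_one_div_sq, show xa - xb = -(xb - xa) by abel,
      sum_torusChar_neg_of_even _ _ (fun q => by simp only [nambuXi, torusBand_neg])]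
    refine congrArg _ (congrArg _ (Finset.sum_congr rfl fun q _ => ?_))
    refine congrArg _ ?_
    rw [timeOrderedPropagator_of_pos β (nambuXi L μ q) hd, nambuXi, fermiFunction]
    push_cast
    rw [one_div, mul_comm, neg_mul (β : ℂ)]
    congr 2
    ring
  · rw [if_neg hσ, if_neg (Ne.symm hσ)]

/-- **The diagonal (`d = 0`, same orbital): the limiting entry is the particle sum minus `½`.** (`Σ_k 1 = L²`.) -/
theorem vertexLimitEntry_zero_eq_particle_sub_half (β μ : ℝ) (x : TorusSite 2 L) (σ : Fin 2) (τ : ℂ) :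
    vertexLimitEntry L β μ x x σ σ 0 =
      (if σ = σ then ((L : ℂ) ^ 2)⁻¹ * ∑ k : TorusSite 2 L, torusChar k (x - x) *
        (Complex.exp (-(τ - τ) * ((torusBand L k - μ : ℝ) : ℂ)) * (fermiFunction β (torusBand L k - μ) : ℂ)) else 0) - 1 / 2 := by
  rw [vertexLimitEntry_eq_torusChar, if_pos rfl, if_pos rfl, cast_one_div_sq, sub_self, sub_self]
  simp only [torusChar_zero_right, one_mul, neg_zero, zero_mul, Complex.exp_zero]
  have hL0 : ((L : ℂ) ^ 2) ≠ 0 := pow_ne_zero _ (Nat.cast_ne_zero.2 (NeZero.ne L))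
  have hcard : (Finset.univ : Finset (TorusSite 2 L)).card = L ^ 2 := by
    rw [Finset.card_univ]; simp [TorusSite, Fintype.card_fin, ZMod.card]
  -- `−L⁻² Σ_q (½ − f) = L⁻² Σ f − ½`
  have hsum : ∑ q : TorusSite 2 L, ((timeOrderedPropagator β (nambuXi L μ q) 0 : ℝ) : ℂ) =
      ∑ q : TorusSite 2 L, ((1 / 2 : ℂ) - (fermiFunction β (torusBand L q - μ) : ℂ)) := by
    refine Finset.sum_congr rfl fun q _ => ?_
    rw [timeOrderedPropagator_zero, nambuXi, fermiFunction]
    push_cast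
    rw [one_div (1 + _)]
  rw [hsum, Finset.sum_sub_distrib, Finset.sum_const, hcard, nsmul_eq_mul]
  push_cast
  rw [mul_sub, inv_mul_cancel_left₀ hL0]
  ring

/-- **The column of the leading annihilation letter (antiperiodicity flip).**  For a creation leg at Grassmann time `a` (operator time
`a − β`) against the external annihilation `c_{yσ′}` at Grassmann time `0` (operator time `0`):
`vertexLimitEntry … x̄ ȳ σ σ′ (0 − a) = +T_{−β}(a − β, 0)` — the Hamiltonian entry being `−T_{−β}(a − β, 0)`. (`a > 0`; uses
`e^{(a−β)ξ} f_{−β}(ξ) = e^{aξ} f_β(ξ)`.) -/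
theorem vertexLimitEntry_extCol_eq_hole (β μ : ℝ) (xa ye : TorusSite 2 L) (σ σ' : Fin 2) {a : ℝ} (ha : 0 < a) :
    vertexLimitEntry L β μ xa ye σ σ' (0 - a) =
      if σ' = σ then ((L : ℂ) ^ 2)⁻¹ * ∑ k : TorusSite 2 L, torusChar k (ye - xa) *
        (Complex.exp (-((0 : ℂ) - ((a - β : ℝ) : ℂ)) * ((torusBand L k - μ : ℝ) : ℂ)) * (fermiFunction (-β) (torusBand L k - μ) : ℂ))
      else 0 := by
  rw [vertexLimitEntry_eq_torusChar]
  by_cases hσ : σ = σ'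
  · subst hσ
    rw [if_pos rfl, if_pos rfl, cast_one_div_sq, show xa - ye = -(ye - xa) by abel,
      sum_torusChar_neg_of_even _ _ (fun q => by simp only [nambuXi, torusBand_neg]), ← mul_neg, ← Finset.sum_neg_distrib]
    refine congrArg _ (Finset.sum_congr rfl fun q _ => ?_)
    rw [← mul_neg]
    refine congrArg _ ?_
    have hneg : (0 : ℝ) - a < 0 := by linarith
    rw [timeOrderedPropagator_of_neg β (nambuXi L μ q) hneg, nambuXi, fermiFunction]
    push_cast
    rw [neg_neg]
    -- `(1+e^{βξ})⁻¹ e^{−ξ(0−a)} = e^{−(0−(a−β))ξ} (1+e^{−βξ})⁻¹`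
    have h1 : (1 : ℂ) + Complex.exp ((β : ℂ) * ((torusBand L q : ℝ) - μ : ℂ)) ≠ 0 := by
      have : (0 : ℝ) < 1 + Real.exp (β * (torusBand L q - μ)) := by positivity
      have h' : ((1 + Real.exp (β * (torusBand L q - μ)) : ℝ) : ℂ) ≠ 0 := Complex.ofReal_ne_zero.2 this.ne'
      push_cast at h'; exact h'
    have h2 : (1 : ℂ) + Complex.exp (-(β : ℂ) * ((torusBand L q : ℝ) - μ : ℂ)) ≠ 0 := by
      have : (0 : ℝ) < 1 + Real.exp (-β * (torusBand L q - μ)) := by positivity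
      have h' := Complex.ofReal_ne_zero.2 this.ne'
      push_cast at h'; exact h'
    rw [show -((0 : ℂ) - ((a : ℂ) - (β : ℂ))) * ((torusBand L q : ℝ) - (μ : ℂ)) =
        -(((torusBand L q : ℝ) - (μ : ℂ)) * ((0 : ℂ) - (a : ℂ))) + (-(β : ℂ) * ((torusBand L q : ℝ) - (μ : ℂ))) by ring,
      Complex.exp_add, show (β : ℂ) * ((torusBand L q : ℝ) - (μ : ℂ)) = -(-(β : ℂ) * ((torusBand L q : ℝ) - (μ : ℂ))) by ring,
      Complex.exp_neg]
    have h3 : Complex.exp (-(β : ℂ) * ((torusBand L q : ℝ) - (μ : ℂ))) ≠ 0 := Complex.exp_ne_zero _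
    field_simp
    ring
  · rw [if_neg hσ, if_neg (Ne.symm hσ), neg_zero]

end Summit.HubbardSuperconductivity.HubbardSuperconductivity.Theorems.TwoPointAssembly

end
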